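import Literature.Barriers.PneNP.RelativizedCircuitSize
import Literature.Barriers.PneNP.RelativizedCircuitSizeCounting
import Literature.Computability.Complexity.BakerGillSolovay
import HarnessLib

/-!
# Barrier catalogue `PneNP`: relativized circuit size — discharge of `Wilson1985_thm_4`

Discharges (D-0014) the named fact `Literature.Barriers.PneNP.Wilson1985_thm_4` of
`Literature/Barriers/PneNP/RelativizedCircuitSize.lean`:

> C. B. Wilson, *Relativized circuit complexity*, J. Comput. System Sci. 31 (1985) 169–181,
> **Theorem 4** (p. 176 = PDF p. 8; held, `lit read paper:doi-10-1016-0022-0000-85-90040-6`):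
> "There exists an oracle `C` such that `NP^C ≠ coNP^C` and `∀ k, P^C ⊄ SIZE^C(n^k)`."

as rendered there over the tree's transcript model of oracle computation (`PRel`, `NPRel`,
`coNPRel`, `Oracle.ofLanguage`; `Oracle.lean`) and oracle circuits `SIZERel C s` (circuits over
`B₂ ∪ oracleGates C`, an oracle gate charged its fan-in, size bound at every length;
`Algebrization.lean`), with the clause `P^C ⊄ SIZE^C(n^k + k)`:
`Wilson1985_thm_4_holds : Wilson1985_thm_4`, PROVED with no hypothesis by carrying out Wilson's
construction (pp. 176–177).

## The printed proof (pp. 176–177) and its formalization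

Wilson: "`L(C) = {x : ∃ y, |y| = |x|, xy ∈ C}` and `L_k(C) = {x : x0^{|x|^{2k+2}} ∈ C}`. Clearly,
for all oracles `C`, `L(C) ∈ NP^C` and `L_k(C) ∈ P^C`. As we construct our `C`, we ensure that
`co-L(C) ∉ NP^C` and that no family of `n^k`-sized circuits will accept `L_k(C)`. ... let `NM_i`
be an enumeration of the nondeterministic oracle machines with polynomial run-time bounds
`p_i(n)`. The construction varies between two steps, the first ensuring that each `NM_i` does
not accept `co-L(C)`, the second that no circuit of size `≤ n^k` accepts `L_k(C)`." Step 1 (for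
`i`): "Increase `n` so that `n` is larger than the length of any string queried or reserved at
any earlier step and `p_i(n) < 2ⁿ`. Run `NM_i` on `0ⁿ` and if it accepts, then choose an
accepting path and some `y` (`|y| = n`) where `0ⁿy` was not queried on that path, and put `0ⁿy`
into `C`, else do nothing (`0ⁿ ∉ L(C)`)." Step 2 (`k ← k + 1`): "Increase `n` [likewise] and
`2ⁿ > n^{2k+1}`. Until all `n`-input 1-output circuits of size `≤ n^k` are cancelled: choose an
unused `x` of length `n`, run all uncancelled circuits on `x`, at least half either accept or
reject, choose the majority; if it is a rejecting majority, put `x0^{n^{2k+2}}` into `C` ...",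
using the FACT (p. 176) "for sufficiently large `n`, the number of subsets of `{0,1}ⁿ` accepted
by circuits of size at most `n^k` relative to a fixed oracle is bounded by `2^{n^{2k+1}}`", and
"No circuit of size `≤ n^k` can query a string of length greater than `n^k`, so adding
`x0^{n^{2k+2}}` to `C` in Step 2 will not affect the behavior of the circuits."

The formalization reuses the stage machinery of the tree's Baker–Gill–Solovay proof
(`BakerGillSolovay.lean`: fresh lengths `BGS.lvl` with `q(n) < 2ⁿ`, unqueried strings
`BGS.pick`, the `NP^B` language `BGS.U` with `BGS.U_mem_NPRel`, the padding codes `BGS.code` /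
`BGS.redFn ∈ FP`, and the locality of runs `Literature.Computability.QuantumComplexity.run_congr`)
and the enumeration of polynomial-time oracle algorithms (`countable_setOf_isPolyTime`,
`PolyTimeCountable.lean`). Deviations from the letter of the printed proof, all inessential:

* `L(C)` is `BGS.U C = {x : ∃ y, |y| ≤ |x|, ⟨x, y⟩ ∈ C}` (in `NP^C` for every `C`,
  `BGS.U_mem_NPRel`), the diagonalizing inputs are `1ⁿ`, the added strings `⟨1ⁿ, w⟩`, `|w| = n`;
  an "`NP^C` machine" is a triple (polynomial-time verifier `M`, clock `q`, certificate bound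
  `p`) as in `NPRel = polyExists ∘ PRel`, enumerated by `Wilson.exists_enum_triple`, and "`NM_i`
  accepts `0ⁿ`" reads: some certificate `y`, `|y| ≤ p(n)`, makes `M` output `true` on `⟨1ⁿ, y⟩`
  within `q(|⟨1ⁿ, y⟩|)` rounds relative to the oracle built so far (`Wilson.NPAcc`). The frozen
  bound after Step 1 covers the candidates `⟨1ⁿ, y⟩` (`|y| ≤ n`), all possible queries of the
  clocked verifier on such inputs (length `≤ Q(n) = q(2n + 2 + p(n))`) and the accepting path's
  queries (`Wilson.npNext`), which is what makes both cases of Step 1 go through against the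
  limit oracle (`Wilson.compl_U_not_mem_NPRel`).
* `L_k(C) = {x : pad_k x ∈ C}` with the self-delimiting padding
  `pad_k x = ⟨1^0, ⟨1^0, ⟨1^{|x|^k + k}, x⟩⟩⟩ = BGS.code 0 0 (|x|^k + k) x` of length
  `2(|x|^k + k) + 6 + |x| > |x|^k + k` in place of `x0^{|x|^{2k+2}}` (`Wilson.pad`, `Wilson.Lk`;
  in `P^C` by the Karp reduction `BGS.redFn 0 0 (X^k + k) ∈ FP` to `C ∈ P^C`,
  `Wilson.Lk_mem_PRel`). Since `SIZERel` bounds the size at every length, it suffices to defeat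
  the circuits of fan-in-charged size `≤ n^k + k` at ONE length `n = n_k` per `k`; an oracle gate
  of such a circuit has fan-in `≤ n^k + k`, shorter than the padded strings (rendering note (1) of
  `RelativizedCircuitSize.lean`).
* Step 2 cancels the circuits by COUNTING instead of by majority vote, through the tree form
  of Wilson's FACT proved in `RelativizedCircuitSizeCounting.lean`
  (`Wilson.exists_fn_not_computed`: for every oracle `A`, exponent `k` and bound `N₀` there are
  a length `n > N₀` and a function `f : {0,1}ⁿ → {0,1}` on which every circuit over
  `B₂ ∪ oracleGates A` of fan-in-charged size `≤ n^k + k` errs somewhere — the circuits are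
  determined by finitely many codes, fewer than `2^{2ⁿ}` for `n` large); Step 2 takes this `n`
  and `f` relative to the oracle built so far (`Wilson.cLen`, `Wilson.cFn`) and puts `pad_k x`
  into `C` exactly for `f x = 1` (`Wilson.cNext`), making `L_k(C) ∩ {0,1}ⁿ = f`
  (`Wilson.Lk_not_mem_SIZERel`).
* The two steps alternate along the schedule `Wilson.sched` (stage `2m`: Step 1 for the `m`-th
  triple; stage `2k + 1`: Step 2 for `k`); the generic freezing lemmas
  (`Wilson.length_of_mem_next`, `Wilson.mem_oracleC_iff_of_le`) express Wilson's "`n` larger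
  than the length of any string queried or reserved at any earlier step".

Also recorded: the hypothesis-free readings of Thm. 4 from `RelativizedCircuitSize.lean`
(`not_relativizes_fixedPoly_upper`, `not_relativizes_NP_eq_coNP`, `exists_np_not_mem_SIZERel`)
and `relativizedCircuitSize_of_thm_3_1` (the barrier now rests on Thm. 3.1 alone).

## References

* C. B. Wilson, *Relativized circuit complexity*, J. Comput. System Sci. 31 (1985) 169–181
  [Wilson1985]: §2 (the model, pp. 171–172), FACT and Thm. 4 with proof (pp. 176–177) — held,
  read with `lit read` (PDF page = journal page − 168).
* T. Baker, J. Gill, R. Solovay, *Relativizations of the P =? NP question*, SIAM J. Comput. 4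
  (1975) 431–442 [BakerGillSolovay1975] (stage diagonalization; the tree's
  `BakerGillSolovay.lean`).
* S. Arora, B. Barak, *Computational Complexity: A Modern Approach*, CUP 2009, Thm. 3.7 and its
  proof (pp. 74–75), §6.1 [AroraBarakCC2009].
-/

namespace Literature.Barriers.PneNP

open _root_.Computability Literature.Computability.Complexity Polynomial

namespace Wilson

/-! ### The diagonal languages `L(C)` and `L_k(C)` -/

section Languages

/-- The padding of `L_k`: Wilson's `x ↦ x0^{|x|^{2k+2}}`, here the code
`⟨1^0, ⟨1^0, ⟨1^{|x|^k + k}, x⟩⟩⟩` of `BakerGillSolovay.lean` (self-delimiting, of length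
`2(|x|^k + k) + 6 + |x| > |x|^k + k`, injective). [cite: Wilson1985, proof of Thm. 4 (p. 176)] -/
def pad (k : ℕ) (x : List Bool) : List Bool := BGS.code 0 0 (x.length ^ k + k) x

/-- Length of the padding. [cite: Wilson1985, proof of Thm. 4 (p. 176)] -/
theorem length_pad (k : ℕ) (x : List Bool) :
    (pad k x).length = 2 * (x.length ^ k + k) + 6 + x.length := by
  rw [pad, BGS.length_code]
  omega

/-- The padding is injective. [folklore] -/
theorem pad_injective {k : ℕ} {x x' : List Bool} (h : pad k x = pad k x') : x = x' :=
  (BGS.code_inj h).2.2.2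

/-- **`L_k(C) = {x : pad_k x ∈ C}`** (Wilson: `L_k(C) = {x : x0^{|x|^{2k+2}} ∈ C}`).
[cite: Wilson1985, proof of Thm. 4 (p. 176)] -/
def Lk (k : ℕ) (A : Language Bool) : Language Bool := {x | pad k x ∈ A}

/-- **`L_k(C) ∈ P^C`** for every oracle `C` ("clearly"): `L_k(C)` Karp-reduces to `C` by the
polynomial-time padding map (`BGS.redFn_mem_FP`), and `P^C` contains `C` and is closed under
Karp reductions. [cite: Wilson1985, proof of Thm. 4 (p. 176)] -/
theorem Lk_mem_PRel (k : ℕ) (A : Language Bool) : Lk k A ∈ PRel (Oracle.ofLanguage A) := by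
  refine mem_PRel_of_karpReducible ⟨BGS.redFn 0 0 (X ^ k + C k), BGS.redFn_mem_FP _ _ _,
    fun x => ?_⟩ (self_mem_PRel_ofLanguage_holds A)
  rw [BGS.redFn_apply]
  simp only [eval_zero, eval_add, eval_pow, eval_X, eval_C]
  exact Iff.rfl

end Languages

/-! ### States and the two kinds of stages -/

/-- The state after a number of stages: the finite set `B` of strings put into the oracle so
far and the bound `N` freezing the membership of every string of length `≤ N` (Wilson: "the
length of any string queried or reserved at any earlier step"). [cite: Wilson1985, proof of Thm. 4 (p. 177)] -/
structure St where
  /-- strings put into the oracle so far -/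
  B : Finset (List Bool)
  /-- all strings of length `≤ N` are frozen -/
  N : ℕ

/-- The language of a state. [folklore] -/
def St.lang (s : St) : Set (List Bool) := ↑s.B

/-- The requirements: a triple (verifier, clock, certificate bound) presenting an `NP^C`
machine to be defeated on `co-L(C)` (Step 1), or an exponent `k` whose `n^k`-size oracle
circuits are to be defeated on `L_k(C)` (Step 2). [cite: Wilson1985, proof of Thm. 4 (p. 177)] -/
abbrev Req : Type := (OracleAlg Bool × Polynomial ℕ × Polynomial ℕ) ⊕ ℕ

section NPStage

variable (D : OracleAlg Bool × Polynomial ℕ × Polynomial ℕ) (s : St)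

/-- The clock of the verifier on inputs `⟨1ⁿ, y⟩`, `|y| ≤ p(n)`: `Q(n) = q(2n + 2 + p(n))`.
[cite: Wilson1985, proof of Thm. 4, Step 1 (p. 177: "`p_i(n) < 2ⁿ`")] -/
noncomputable def npPoly : Polynomial ℕ := D.2.1.comp (C 2 * X + C 2 + D.2.2)

/-- Evaluation of `npPoly`. [folklore] -/
theorem eval_npPoly (n : ℕ) : (npPoly D).eval n = D.2.1.eval (2 * n + 2 + D.2.2.eval n) := by
  simp [npPoly, eval_comp]

/-- The length of Step 1: fresh (`> N`) with `Q(n) < 2ⁿ`. [cite: Wilson1985, proof of Thm. 4, Step 1 (p. 177)] -/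
noncomputable def npLvl : ℕ := BGS.lvl (npPoly D) s.N

/-- The Step-1 length exceeds the frozen bound. [cite: Wilson1985, proof of Thm. 4, Step 1 (p. 177)] -/
theorem lt_npLvl : s.N < npLvl D s := BGS.lt_lvl _ _

/-- "`NM_i` accepts `0ⁿ`" relative to the oracle built so far: some certificate `y`,
`|y| ≤ p(n)`, makes the verifier accept `⟨1ⁿ, y⟩` within its clock. [cite: Wilson1985, proof of Thm. 4, Step 1 (p. 177)] -/
def NPAcc (n : ℕ) : Prop :=
  ∃ y : List Bool, y.length ≤ D.2.2.eval n ∧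
    D.1.run (Oracle.ofLanguage s.lang) (D.2.1.eval (boolPair (ones n) y).length)
      (boolPair (ones n) y) = some true

open Classical in
/-- An accepting certificate ("choose an accepting path"; junk `[]` if there is none).
[cite: Wilson1985, proof of Thm. 4, Step 1 (p. 177)] -/
noncomputable def npCert : List Bool :=
  if h : NPAcc D s (npLvl D s) then Classical.choose h else []

/-- The accepted input `⟨1ⁿ, y⟩`. [cite: Wilson1985, proof of Thm. 4, Step 1 (p. 177)] -/
noncomputable def npInput : List Bool := boolPair (ones (npLvl D s)) (npCert D s)

/-- The queries of the accepting path. [cite: Wilson1985, proof of Thm. 4, Step 1 (p. 177)] -/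
noncomputable def npQs : List (List Bool) :=
  D.1.queries (Oracle.ofLanguage s.lang) (D.2.1.eval (npInput D s).length) (npInput D s)

/-- The string `⟨1ⁿ, w⟩`, `|w| = n`, not queried on the accepting path ("some `y` (`|y| = n`)
where `0ⁿy` was not queried on that path"). [cite: Wilson1985, proof of Thm. 4, Step 1 (p. 177)] -/
noncomputable def npAdd : List Bool :=
  boolPair (ones (npLvl D s)) (BGS.pick (ones (npLvl D s)) (npLvl D s) (npQs D s))

open Classical in
/-- **Step 1** for the machine `D = (M, q, p)`: if some certificate is accepted relative to the
oracle so far, put the unqueried `⟨1ⁿ, w⟩` into the oracle (so `1ⁿ ∈ L(C)` although the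
machine claims the complement), else nothing (`1ⁿ ∉ L(C)`); then freeze the candidates
`⟨1ⁿ, y⟩` (`|y| ≤ n`), every possible query of the clocked verifier on `⟨1ⁿ, y⟩`, `|y| ≤ p(n)`
(length `≤ Q(n)`), and every query of the accepting path. [cite: Wilson1985, proof of Thm. 4, Step 1 (p. 177)] -/
noncomputable def npNext : St where
  B := if NPAcc D s (npLvl D s) then insert (npAdd D s) s.B else s.B
  N := 3 * npLvl D s + 2 + (npPoly D).eval (npLvl D s) + ((npQs D s).map List.length).sum

/-- Specification of the accepting certificate. [cite: Wilson1985, proof of Thm. 4, Step 1 (p. 177)] -/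
theorem npCert_spec (h : NPAcc D s (npLvl D s)) :
    (npCert D s).length ≤ D.2.2.eval (npLvl D s) ∧
      D.1.run (Oracle.ofLanguage s.lang) (D.2.1.eval (npInput D s).length) (npInput D s) =
        some true := by
  unfold npInput npCert
  rw [dif_pos h]
  exact Classical.choose_spec h

/-- The accepted input is short: `|⟨1ⁿ, y⟩| ≤ 2n + 2 + p(n)`. [folklore] -/
theorem length_npInput_le (h : NPAcc D s (npLvl D s)) :
    (npInput D s).length ≤ 2 * npLvl D s + 2 + D.2.2.eval (npLvl D s) := by
  have := (npCert_spec D s h).1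
  unfold npInput
  rw [length_boolPair, List.length_replicate]
  omega

/-- The accepting path makes fewer than `2ⁿ` queries. [cite: Wilson1985, proof of Thm. 4, Step 1 (p. 177: "`p_i(n) < 2ⁿ`")] -/
theorem length_npQs_lt (h : NPAcc D s (npLvl D s)) : (npQs D s).length < 2 ^ npLvl D s :=
  calc (npQs D s).length ≤ D.2.1.eval (npInput D s).length := D.1.length_queries_le _ _ _
    _ ≤ (npPoly D).eval (npLvl D s) := by
        rw [eval_npPoly]
        exact TM2Iter.eval_mono _ (length_npInput_le D s h)
    _ < 2 ^ npLvl D s := BGS.eval_lvl_lt _ _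

/-- The added string has length `3n + 2`, was not queried on the accepting path, and is a
candidate `⟨1ⁿ, w⟩` with `|w| = n`. [cite: Wilson1985, proof of Thm. 4, Step 1 (p. 177)] -/
theorem npAdd_spec (h : NPAcc D s (npLvl D s)) :
    (npAdd D s).length = 3 * npLvl D s + 2 ∧ npAdd D s ∉ npQs D s ∧
      ∃ w : List Bool, w.length = npLvl D s ∧ npAdd D s = boolPair (ones (npLvl D s)) w := by
  obtain ⟨hlen, hnot⟩ := BGS.pick_spec (ones (npLvl D s)) (length_npQs_lt D s h)
  refine ⟨?_, hnot, _, hlen, rfl⟩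
  unfold npAdd
  rw [length_boolPair, hlen, List.length_replicate]
  omega

/-- Membership in the state after Step 1. [folklore] -/
theorem mem_npNext_iff (u : List Bool) :
    u ∈ (npNext D s).B ↔ u ∈ s.B ∨ (NPAcc D s (npLvl D s) ∧ u = npAdd D s) := by
  unfold npNext
  dsimp only
  split_ifs with h
  · rw [Finset.mem_insert]
    tauto
  · tauto

/-- The frozen bound after Step 1. [folklore] -/
theorem npNext_N : (npNext D s).N =
    3 * npLvl D s + 2 + (npPoly D).eval (npLvl D s) + ((npQs D s).map List.length).sum := rfl

end NPStage

section CircStage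

variable (k : ℕ) (s : St)

/-- **The length of Step 2 for the exponent `k`** (relative to the oracle so far): a fresh
`n > N` carrying a Boolean function on `n` bits computed by no circuit over `B₂ ∪ oracleGates`
of fan-in-charged size `≤ n^k + k` (`Wilson.exists_fn_not_computed`, the tree form of Wilson's
FACT, `RelativizedCircuitSizeCounting.lean`; Wilson: "increase `n` so that ... `2ⁿ > n^{2k+1}`").
[cite: Wilson1985, proof of Thm. 4, Step 2 (p. 177)] -/
noncomputable def cLen : ℕ := Classical.choose (exists_fn_not_computed s.lang k s.N)

/-- Specification of the Step-2 length. [cite: Wilson1985, proof of Thm. 4, Step 2 (p. 177)] -/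
theorem cLen_spec : s.N < cLen k s ∧ ∃ f : (Fin (cLen k s) → Bool) → Bool,
    ∀ c : Circuit (Fin (cLen k s)), c.IsOver (B2 ∪ oracleGates s.lang) →
      oracleSize c ≤ cLen k s ^ k + k → ∃ v, c.eval v ≠ f v :=
  Classical.choose_spec (exists_fn_not_computed s.lang k s.N)

/-- The Step-2 length exceeds the frozen bound. [cite: Wilson1985, proof of Thm. 4, Step 2 (p. 177)] -/
theorem lt_cLen : s.N < cLen k s := (cLen_spec k s).1

/-- The function diagonalized into `L_k(C)` at Step 2: computed by no small circuit relative to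
the oracle so far (Wilson cancels the circuits one by one by majority vote; here all at once by
counting). [cite: Wilson1985, proof of Thm. 4, Step 2 (p. 177)] -/
noncomputable def cFn : (Fin (cLen k s) → Bool) → Bool := Classical.choose (cLen_spec k s).2

/-- Specification of the diagonal function: every small circuit relative to the oracle so far
errs on it somewhere. [cite: Wilson1985, proof of Thm. 4, Step 2 (p. 177)] -/
theorem cFn_spec (c : Circuit (Fin (cLen k s))) (hB : c.IsOver (B2 ∪ oracleGates s.lang))
    (hs : oracleSize c ≤ cLen k s ^ k + k) : ∃ v, c.eval v ≠ cFn k s v :=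
  Classical.choose_spec (cLen_spec k s).2 c hB hs

/-- The strings `pad_k x`, `f(x) = 1`, put into the oracle at Step 2 ("put `x0^{n^{2k+2}}` into
`C`"). [cite: Wilson1985, proof of Thm. 4, Step 2 (p. 177)] -/
noncomputable def cAdd : Finset (List Bool) :=
  (Finset.univ.filter fun x => cFn k s x = true).image fun x => pad k (List.ofFn x)

/-- **Step 2** for the exponent `k`: at the fresh length `n = cLen k s` make
`L_k(C) ∩ {0,1}ⁿ` the diagonal function, and freeze everything up to the length of the padded
strings (which exceeds `n^k + k`, the largest possible fan-in of an oracle gate of a circuit of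
fan-in-charged size `≤ n^k + k`: "no circuit of size `≤ n^k` can query a string of length
greater than `n^k`"). [cite: Wilson1985, proof of Thm. 4, Step 2 (p. 177)] -/
noncomputable def cNext : St where
  B := s.B ∪ cAdd k s
  N := 2 * (cLen k s ^ k + k) + 6 + cLen k s

/-- Membership in the set of added strings. [folklore] -/
theorem mem_cAdd_iff (u : List Bool) :
    u ∈ cAdd k s ↔ ∃ x : Fin (cLen k s) → Bool, cFn k s x = true ∧ pad k (List.ofFn x) = u := by
  simp [cAdd]

/-- The added strings have the length of the new frozen bound. [folklore] -/
theorem length_of_mem_cAdd {u : List Bool} (hu : u ∈ cAdd k s) :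
    u.length = 2 * (cLen k s ^ k + k) + 6 + cLen k s := by
  obtain ⟨x, -, rfl⟩ := (mem_cAdd_iff k s u).1 hu
  rw [length_pad, List.length_ofFn]

/-- Membership in the state after Step 2. [folklore] -/
theorem mem_cNext_iff (u : List Bool) : u ∈ (cNext k s).B ↔ u ∈ s.B ∨ u ∈ cAdd k s :=
  Finset.mem_union

/-- The frozen bound after Step 2. [folklore] -/
theorem cNext_N : (cNext k s).N = 2 * (cLen k s ^ k + k) + 6 + cLen k s := rfl

end CircStage

/-! ### The construction: alternating the two steps -/

section Construction

/-- One stage: Step 1 for a machine, or Step 2 for an exponent. [cite: Wilson1985, proof of Thm. 4 (p. 177)] -/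
noncomputable def next : Req → St → St
  | Sum.inl D, s => npNext D s
  | Sum.inr k, s => cNext k s

/-- Stages only add strings. [folklore] -/
theorem subset_next (r : Req) (s : St) : s.B ⊆ (next r s).B := by
  rcases r with D | k
  · intro u hu
    exact (mem_npNext_iff D s u).2 (Or.inl hu)
  · intro u hu
    exact (mem_cNext_iff k s u).2 (Or.inl hu)

/-- The frozen bound does not decrease. [folklore] -/
theorem N_le_next (r : Req) (s : St) : s.N ≤ (next r s).N := by
  rcases r with D | k
  · have := lt_npLvl D s
    show s.N ≤ (npNext D s).N
    rw [npNext_N]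
    omega
  · have := lt_cLen k s
    show s.N ≤ (cNext k s).N
    rw [cNext_N]
    omega

/-- **A stage adds only strings longer than the old frozen bound and within the new one**
(Wilson: `n` "larger than the length of any string queried or reserved at any earlier step").
[cite: Wilson1985, proof of Thm. 4 (p. 177)] -/
theorem length_of_mem_next (r : Req) (s : St) {u : List Bool} (hu : u ∈ (next r s).B)
    (hu' : u ∉ s.B) : s.N < u.length ∧ u.length ≤ (next r s).N := by
  rcases r with D | k
  · change u ∈ (npNext D s).B at hu
    rcases (mem_npNext_iff D s u).1 hu with h | ⟨hacc, rfl⟩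
    · exact absurd h hu'
    · have h1 := (npAdd_spec D s hacc).1
      have h2 := lt_npLvl D s
      show s.N < (npAdd D s).length ∧ (npAdd D s).length ≤ (npNext D s).N
      rw [npNext_N]
      omega
  · change u ∈ (cNext k s).B at hu
    rcases (mem_cNext_iff k s u).1 hu with h | h
    · exact absurd h hu'
    · have h1 := length_of_mem_cAdd k s h
      have h2 := lt_cLen k s
      show s.N < u.length ∧ u.length ≤ (cNext k s).N
      rw [cNext_N]
      omega

variable (e : ℕ → OracleAlg Bool × Polynomial ℕ × Polynomial ℕ)

/-- The schedule: even stages serve the machines `e 0, e 1, …` (Step 1), odd stages the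
exponents `k = 0, 1, …` (Step 2) ("the construction varies between two steps").
[cite: Wilson1985, proof of Thm. 4 (p. 177)] -/
def sched (i : ℕ) : Req := if i % 2 = 0 then Sum.inl (e (i / 2)) else Sum.inr (i / 2)

/-- Stage `2m` serves the machine `e m`. [folklore] -/
theorem sched_two_mul (m : ℕ) : sched e (2 * m) = Sum.inl (e m) := by
  unfold sched
  rw [if_pos (by omega), Nat.mul_div_cancel_left m (by norm_num)]

/-- Stage `2k + 1` serves the exponent `k`. [folklore] -/
theorem sched_two_mul_add_one (k : ℕ) : sched e (2 * k + 1) = Sum.inr k := by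
  unfold sched
  rw [if_neg (by omega)]
  congr 1
  omega

/-- The stages of the construction ("Initially `C ← ∅`"). [cite: Wilson1985, proof of Thm. 4 (p. 177)] -/
noncomputable def stage : ℕ → St
  | 0 => ⟨∅, 0⟩
  | i + 1 => next (sched e i) (stage i)

/-- **Wilson's oracle `C`**: the union of the stages. [cite: Wilson1985, Thm. 4 (pp. 176–177)] -/
def oracleC : Set (List Bool) := {u | ∃ i, u ∈ (stage e i).B}

/-- Stage `i + 1` unfolds to `next`. [folklore] -/
theorem stage_succ (i : ℕ) : stage e (i + 1) = next (sched e i) (stage e i) := rfl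

/-- The stages are cumulative. [folklore] -/
theorem B_mono {i j : ℕ} (h : i ≤ j) : (stage e i).B ⊆ (stage e j).B := by
  induction h with
  | refl => exact Finset.Subset.refl _
  | step _ ih => exact ih.trans (subset_next _ _)

/-- The frozen bounds are monotone. [folklore] -/
theorem N_mono {i j : ℕ} (h : i ≤ j) : (stage e i).N ≤ (stage e j).N := by
  induction h with
  | refl => exact le_rfl
  | step _ ih => exact ih.trans (N_le_next _ _)

/-- Every string of stage `i` has length at most the frozen bound `Nᵢ`. [folklore] -/
theorem length_le_N_of_mem {i : ℕ} {u : List Bool} (hu : u ∈ (stage e i).B) :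
    u.length ≤ (stage e i).N := by
  induction i with
  | zero => exact absurd hu (Finset.notMem_empty u)
  | succ i ih =>
    by_cases h : u ∈ (stage e i).B
    · exact (ih h).trans (N_le_next _ _)
    · exact (length_of_mem_next _ _ hu h).2

/-- **Freezing**: a string of length `≤ Nᵢ₊₁` belongs to a later stage iff it belongs to stage
`i + 1`. [cite: Wilson1985, proof of Thm. 4 (p. 177)] -/
theorem mem_stage_iff_of_le {i : ℕ} {u : List Bool} (hu : u.length ≤ (stage e (i + 1)).N) :
    ∀ {j : ℕ}, i + 1 ≤ j → (u ∈ (stage e j).B ↔ u ∈ (stage e (i + 1)).B) := by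
  intro j hj
  induction hj with
  | refl => exact Iff.rfl
  | @step j hij ih =>
    rw [← ih]
    constructor
    · intro h
      by_contra h'
      have h1 := (length_of_mem_next _ _ h h').1
      have h2 := N_mono e hij
      omega
    · intro h
      exact subset_next _ _ h

/-- **Freezing for the limit oracle**: a string of length `≤ Nᵢ₊₁` is in `C` iff it is in stage
`i + 1`. [cite: Wilson1985, proof of Thm. 4 (p. 177)] -/
theorem mem_oracleC_iff_of_le {i : ℕ} {u : List Bool} (hu : u.length ≤ (stage e (i + 1)).N) :
    u ∈ oracleC e ↔ u ∈ (stage e (i + 1)).B := by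
  constructor
  · rintro ⟨j, hj⟩
    rcases le_total (i + 1) j with hij | hji
    · exact (mem_stage_iff_of_le e hu hij).1 hj
    · exact B_mono e hji hj
  · intro h
    exact ⟨i + 1, h⟩

/-! ### Step 1 defeats every `NP^C` machine on `co-L(C)` -/

/-- **`co-L(C) ∉ NP^C`** for `L(C) = U_C = {x : ∃ y, |y| ≤ |x|, ⟨x, y⟩ ∈ C}`, provided `e`
enumerates all (polynomial-time verifier, clock, certificate bound) triples: the triple
`(M, q, p) = e m` errs on `1ⁿ`, `n` the length of stage `2m`. If some certificate was accepted
relative to the stage oracle, the accepting run survives in `C` (its queries are frozen and the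
added string was not among them), so the machine puts `1ⁿ` into the complement although the
added `⟨1ⁿ, w⟩` puts `1ⁿ` into `L(C)`; if none was, no candidate `⟨1ⁿ, y⟩` ever enters `C`, so
`1ⁿ ∈ co-L(C)` and some certificate is accepted relative to `C`, hence (its queries being
shorter than `Q(n)`, frozen, nothing added) relative to the stage oracle — a contradiction.
[cite: Wilson1985, proof of Thm. 4, Step 1 (p. 177)] -/
theorem compl_U_not_mem_NPRel
    (he : {D : OracleAlg Bool × Polynomial ℕ × Polynomial ℕ | D.1.IsPolyTime encodingBoolBool} ⊆
      Set.range e) :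
    (BGS.U (oracleC e))ᶜ ∉ NPRel (Oracle.ofLanguage (oracleC e)) := by
  rintro ⟨L', ⟨M, hM, q, hq⟩, p, hp⟩
  obtain ⟨m, hm⟩ := he (show (M, q, p) ∈
    {D : OracleAlg Bool × Polynomial ℕ × Polynomial ℕ | D.1.IsPolyTime encodingBoolBool} from hM)
  have h1 : (e m).1 = M := by rw [hm]
  have h2 : (e m).2.1 = q := by rw [hm]
  have h3 : (e m).2.2 = p := by rw [hm]
  rw [← h1, ← h2] at hq
  rw [← h3] at hp
  set D := e m with hD
  set s := stage e (2 * m) with hs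
  set n := npLvl D s with hn
  have hstage : stage e (2 * m + 1) = npNext D s := by
    rw [stage_succ, sched_two_mul]
    rfl
  have hNn : s.N < n := lt_npLvl D s
  have hfreeze : ∀ u : List Bool, u.length ≤ (npNext D s).N →
      (u ∈ oracleC e ↔ u ∈ (npNext D s).B) := by
    intro u hu
    rw [← hstage] at hu ⊢
    exact mem_oracleC_iff_of_le e hu
  by_cases hacc : NPAcc D s n
  · -- an accepting certificate relative to the stage oracle
    obtain ⟨hcert, hrun⟩ := npCert_spec D s hacc
    obtain ⟨-, hnotq, w, hw, hadd⟩ := npAdd_spec D s hacc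
    have hrunC : D.1.run (Oracle.ofLanguage (oracleC e)) (D.2.1.eval (npInput D s).length)
        (npInput D s) = some true := by
      rw [← hrun]
      refine Literature.Computability.QuantumComplexity.run_congr D.1 fun v hv => ?_
      refine Oracle.ofLanguage_apply_eq_of_iff ?_
      have hvlen : v.length ≤ (npNext D s).N := by
        rw [npNext_N]
        have : v.length ≤ ((npQs D s).map List.length).sum :=
          List.single_le_sum (fun _ _ => Nat.zero_le _) _ (List.mem_map.2 ⟨v, hv, rfl⟩)
        omega
      rw [hfreeze v hvlen, mem_npNext_iff]
      constructor
      · rintro (h | ⟨-, rfl⟩)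
        · exact h
        · exact absurd hv hnotq
      · exact Or.inl
    have hL' : npInput D s ∈ L' := by
      have := (hq (npInput D s)).1
      rw [hrunC, Option.some.injEq] at this
      exact (Set.mem_iff_boolIndicator _ _).2 this.symm
    have hnU : ones n ∈ (BGS.U (oracleC e))ᶜ :=
      (hp (ones n)).2 ⟨npCert D s, by rw [List.length_replicate]; exact hcert, hL'⟩
    have hU : ones n ∈ BGS.U (oracleC e) := by
      refine ⟨w, by rw [hw, List.length_replicate], ?_⟩
      rw [← hadd]
      exact ⟨2 * m + 1, by rw [hstage]; exact (mem_npNext_iff D s _).2 (Or.inr ⟨hacc, rfl⟩)⟩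
    exact hnU hU
  · -- no accepting certificate relative to the stage oracle
    have hnotU : ones n ∉ BGS.U (oracleC e) := by
      rintro ⟨y, hy, hyC⟩
      rw [List.length_replicate] at hy
      have hlen : (boolPair (ones n) y).length ≤ (npNext D s).N := by
        rw [npNext_N, length_boolPair, List.length_replicate]
        omega
      rw [hfreeze _ hlen, mem_npNext_iff] at hyC
      rcases hyC with h | ⟨h, -⟩
      · have := length_le_N_of_mem e h
        change _ ≤ s.N at this
        rw [length_boolPair, List.length_replicate] at this
        omega
      · exact hacc h
    obtain ⟨y, hy, hyL'⟩ := (hp (ones n)).1 hnotU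
    rw [List.length_replicate] at hy
    obtain ⟨hrunz, hqz⟩ := hq (boolPair (ones n) y)
    rw [(Set.mem_iff_boolIndicator _ _).1 hyL'] at hrunz
    have hrunB : D.1.run (Oracle.ofLanguage s.lang) (D.2.1.eval (boolPair (ones n) y).length)
        (boolPair (ones n) y) = some true := by
      rw [← hrunz]
      refine Literature.Computability.QuantumComplexity.run_congr D.1 fun v hv => ?_
      refine Oracle.ofLanguage_apply_eq_of_iff ?_
      have hvlen : v.length ≤ (npNext D s).N := by
        refine (hqz v hv).trans ?_
        rw [npNext_N]
        have : D.2.1.eval (boolPair (ones n) y).length ≤ (npPoly D).eval n := by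
          rw [eval_npPoly]
          exact TM2Iter.eval_mono _ (by rw [length_boolPair, List.length_replicate]; omega)
        rw [← hn]
        omega
      rw [hfreeze v hvlen, mem_npNext_iff]
      constructor
      · exact Or.inl
      · rintro (h | ⟨h, -⟩)
        · exact h
        · exact absurd h hacc
    exact hacc ⟨y, hy, hrunB⟩

/-! ### Step 2 defeats every small circuit family on `L_k(C)` -/

/-- **`L_k(C) ∉ SIZE^C(n^k + k)`**: at the length `n` of stage `2k + 1`, the `n`-th circuit of a
deciding family of fan-in-charged size `≤ n^k + k` is a circuit relative to the stage oracle
(its oracle gates have fan-in `≤ n^k + k`, below the new frozen bound, and the strings added at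
the stage are longer), and computes `L_k(C) ∩ {0,1}ⁿ`, which is the hard function (the padded
strings are frozen right after the stage, and earlier stages hold only shorter strings) — but
the hard function is computed by no such circuit. [cite: Wilson1985, proof of Thm. 4, Step 2 (p. 177)] -/
theorem Lk_not_mem_SIZERel (k : ℕ) :
    Lk k (oracleC e) ∉ SIZERel (oracleC e) (fun n => n ^ k + k) := by
  rintro ⟨Cf, hCf, hdec⟩
  set s := stage e (2 * k + 1) with hs
  set n := cLen k s with hn
  have hstage : stage e (2 * k + 1 + 1) = cNext k s := by
    rw [stage_succ, sched_two_mul_add_one]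
    rfl
  have hNn : s.N < n := lt_cLen k s
  have hfreeze : ∀ u : List Bool, u.length ≤ (cNext k s).N →
      (u ∈ oracleC e ↔ u ∈ (cNext k s).B) := by
    intro u hu
    rw [← hstage] at hu ⊢
    exact mem_oracleC_iff_of_le e hu
  obtain ⟨hover, hsize⟩ := hCf n
  -- the `n`-th circuit is a circuit relative to the stage oracle
  have hover' : (Cf n).IsOver (B2 ∪ oracleGates s.lang) := by
    intro g hg
    rcases hover g hg with h | ⟨m, hm⟩
    · exact Or.inl h
    · by_cases hm2 : m ≤ 2
      · left
        show g.fn.1 ≤ 2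
        rw [hm]
        exact hm2
      · right
        refine ⟨m, ?_⟩
        rw [hm]
        have hmle : m ≤ n ^ k + k := by
          have h1 := oracleGateCost_le_oracleSize (Cf n) hg
          rw [hm] at h1
          unfold oracleGateCost at h1
          rw [if_neg hm2] at h1
          exact h1.trans hsize
        congr 1
        funext v
        unfold Language.sliceFn
        rw [Bool.eq_iff_iff, ← Set.mem_iff_boolIndicator, ← Set.mem_iff_boolIndicator,
          hfreeze _ (by rw [List.length_ofFn, cNext_N, ← hn]; omega), mem_cNext_iff]
        constructor
        · rintro (h | h)
          · exact h
          · have := length_of_mem_cAdd k s h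
            rw [List.length_ofFn, ← hn] at this
            omega
        · exact Or.inl
  obtain ⟨v, hv⟩ := cFn_spec k s (Cf n) hover' hsize
  apply hv
  rw [hdec.eval_eq v]
  have hiff : List.ofFn v ∈ Lk k (oracleC e) ↔ cFn k s v = true := by
    show pad k (List.ofFn v) ∈ oracleC e ↔ _
    rw [hfreeze _ (by rw [length_pad, List.length_ofFn, cNext_N, ← hn]), mem_cNext_iff, mem_cAdd_iff]
    constructor
    · rintro (h | ⟨x, hx, hxv⟩)
      · have := length_le_N_of_mem e h
        change _ ≤ s.N at this
        rw [length_pad, List.length_ofFn] at this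
        omega
      · rwa [← List.ofFn_injective (pad_injective hxv)]
    · intro h
      exact Or.inr ⟨v, h, rfl⟩
  rw [Bool.eq_iff_iff, ← Set.mem_iff_boolIndicator]
  exact hiff

end Construction

/-! ### The enumeration and the theorem -/

/-- Some sequence enumerates all triples of a polynomial-time oracle algorithm and two
polynomials (verifier, clock, certificate bound): "let `NM_i` be an enumeration of the
nondeterministic oracle machines with polynomial run-time bounds `p_i(n)`" (from
`countable_setOf_isPolyTime`). [cite: Wilson1985, proof of Thm. 4 (p. 177)] -/
theorem exists_enum_triple :
    ∃ e : ℕ → OracleAlg Bool × Polynomial ℕ × Polynomial ℕ,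
      {D | D.1.IsPolyTime encodingBoolBool} ⊆ Set.range e := by
  haveI : Nonempty (OracleAlg Bool) := ⟨OracleAlg.ofFun fun _ => false⟩
  haveI : Countable (Polynomial ℕ) := Literature.Computability.QuantumComplexity.countable_polynomial_nat
  refine Set.countable_iff_exists_subset_range.1 ?_
  have h : {D : OracleAlg Bool × Polynomial ℕ × Polynomial ℕ | D.1.IsPolyTime encodingBoolBool} ⊆
      {M : OracleAlg Bool | M.IsPolyTime encodingBoolBool} ×ˢ
        (Set.univ : Set (Polynomial ℕ × Polynomial ℕ)) :=
    fun D hD => ⟨hD, trivial⟩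
  exact ((countable_setOf_isPolyTime encodingBoolBool).prod Set.countable_univ).mono h

/-- **Wilson's Theorem 4, constructed**: for an enumeration `e` of all verifier triples, the
oracle `C = oracleC e` has `NP^C ≠ coNP^C` (the `NP^C` language `L(C) = U_C` is not in
`coNP^C`) and, for every `k`, the `P^C` language `L_k(C)` outside `SIZE^C(n^k + k)`.
[cite: Wilson1985, Thm. 4 (pp. 176–177)] -/
theorem oracleC_spec (e : ℕ → OracleAlg Bool × Polynomial ℕ × Polynomial ℕ)
    (he : {D : OracleAlg Bool × Polynomial ℕ × Polynomial ℕ | D.1.IsPolyTime encodingBoolBool} ⊆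
      Set.range e) :
    NPRel (Oracle.ofLanguage (oracleC e)) ≠ coNPRel (Oracle.ofLanguage (oracleC e)) ∧
      ∀ k : ℕ, ¬ PRel (Oracle.ofLanguage (oracleC e)) ⊆ SIZERel (oracleC e) (fun n => n ^ k + k) := by
  refine ⟨fun heq => ?_, fun k hsub => Lk_not_mem_SIZERel e k (hsub (Lk_mem_PRel k _))⟩
  have hU := BGS.U_mem_NPRel (oracleC e)
  rw [heq] at hU
  exact compl_U_not_mem_NPRel e he hU

end Wilson

/-- **Wilson 1985, Theorem 4, discharged**: "There exists an oracle `C` such that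
`NP^C ≠ coNP^C` and `∀ k, P^C ⊄ SIZE^C(n^k)`" — the named fact `Wilson1985_thm_4` of
`RelativizedCircuitSize.lean` holds (oracle `Wilson.oracleC`, built by alternating Wilson's
Step 1 against an enumeration of all `NP^C` machines and Step 2 against all `n^k`-size oracle
circuits, the latter cancelled by counting). [cite: Wilson1985, Thm. 4 (pp. 176–177)] -/
theorem Wilson1985_thm_4_holds : Wilson1985_thm_4 := by
  obtain ⟨e, he⟩ := Wilson.exists_enum_triple
  exact ⟨Wilson.oracleC e, Wilson.oracleC_spec e he⟩

/-- The barrier `RelativizedCircuitSize` reduces to its first conjunct (Thm. 3.1): the second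
(Thm. 4) is discharged. [cite: Wilson1985, Thms. 3.1 and 4] -/
theorem relativizedCircuitSize_of_thm_3_1 (h : Wilson1985_thm_3_1) : RelativizedCircuitSize :=
  ⟨h, Wilson1985_thm_4_holds⟩

/-- Hypothesis-free reading of Thm. 4: fixed-polynomial circuit upper bounds for `P` do not
relativize. [cite: Wilson1985, §1.2 (b) (p. 170) and Thm. 4] -/
theorem not_relativizes_fixedPoly_upper {Φ : Oracle → Prop}
    (hΦ : ∀ A : Language Bool, Φ (Oracle.ofLanguage A) →
      ∃ k : ℕ, PRel (Oracle.ofLanguage A) ⊆ SIZERel A (fun n => n ^ k + k)) :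
    ¬ Relativizes Φ :=
  Wilson1985_thm_4_holds.not_relativizes_fixedPoly_upper hΦ

/-- Hypothesis-free reading of Thm. 4: `NP = coNP` does not relativize. [cite: Wilson1985, Thm. 4] -/
theorem not_relativizes_NP_eq_coNP : ¬ Relativizes fun O => NPRel O = coNPRel O :=
  Wilson1985_thm_4_holds.not_relativizes_NP_eq_coNP

/-- Hypothesis-free reading of Thm. 4: relative to Wilson's `C`, for every `k` some language of
`NP^C` lies outside `SIZE^C(n^k + k)` (with the discharged tree fact `P^O ⊆ NP^O`).
[cite: Wilson1985, Thm. 4 and p. 178] -/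
theorem exists_np_not_mem_SIZERel :
    ∃ C : Language Bool, ∀ k : ℕ,
      ∃ L ∈ NPRel (Oracle.ofLanguage C), L ∉ SIZERel C (fun n => n ^ k + k) :=
  Wilson1985_thm_4_holds.exists_np_not_mem_SIZERel PRel_subset_NPRel_holds

end Literature.Barriers.PneNP
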